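import Mathlib
import Summits.Ventures.PercRepro2.CoinChainScQprimeLemmas

/-!
# (Q′) — THE UNIVERSAL PURE AND-SWITCH CHAIN (blind cell PercRepro2, night-2 g24;
proofs/NIGHT2-DARC.md §64)

The statement of record of §62.5, `(Q′) a0²·U111 + (b0 − g0)·Δ ≥ 0`, is a THEOREM of the kernel
class: `pureChain_Qprime`.  Proof: the ideal part pays the pivotal need up to the factor
`P₀/r = (r − g)/r` — in the anti-aligned pattern `P₀ |ε φ| ≤ (P₀/r)·m (p₁ − pI)(q₁ − qI) ≤ (P₀/r)·Iₚ`
by `p₀ ≥ pI` (`ideal_le_global`) and the CLOSED-GATE one-marker bound `r (q₀ − q₁) ≤ m (q₁ − qI)`,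
i.e. `q₀ ≤ q_{rD}` (`mean_le_tilt` + `tilt_upset_mean`), with the ideal FKG
`(m b1 − b0 xI)(m b2 − b0 yI) ≤ m Iₚ` — and the gate-only inequality (SC) `r Dₚ + g Iₚ ≥ 0`
(`pureChain_SC`) supplies the rest: `a0² (Iₚ + Dₚ) + (r − g) Δ ≥ (r − g)/r · (a0² Iₚ − r |Δ|) ≥ 0`
(`qprime_of_sc_alg`).  Hence `pureChain_functional_nonneg_universal`: the pure chain functional is
nonnegative at EVERY `ρ ∈ [0, 1]` for every pair of nonnegative increasing markers — the open
hypothesis `hcase` of `pureChain_functional_nonneg_of_sixCases` is discharged.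
-/

namespace Summit.Ventures.PercRepro2.Coin

open Classical

section QprimeMain

variable {V : Type*} [DecidableEq V] {R : Type*} [Field R] [LinearOrder R] [IsStrictOrderedRing R]

set_option maxHeartbeats 400000 in
/-- **(Q′) IS A THEOREM**: `a0²·U111 + (b0 − g0)·Δ ≥ 0` for the pure chain — the hypothesis `hQ` of
`pureChain_functional_nonneg_of_Qprime`, discharged.  Hypotheses: the head hypotheses of
`chain_world1_nonneg`, `d' ≤ d`, nonnegative increasing markers, positive world masses and a
positive ideal mass. -/
theorem pureChain_Qprime (U ent' : Finset V) (ν c d d' : Finset V → R)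
    (hν0 : ∀ W, 0 ≤ ν W) (hν : ∀ s ⊆ U, ∀ t ⊆ U, ν s * ν t ≤ ν (s ∩ t) * ν (s ∪ t))
    (hc0 : ∀ W, 0 ≤ c W) (hd0 : ∀ W, 0 ≤ d W) (hd'0 : ∀ W, 0 ≤ d' W)
    (hdc : ∀ W, d W ≤ c W) (hd'c : ∀ W, d' W ≤ c W) (hd'd : ∀ W, d' W ≤ d W)
    (hcc : ∀ s t, c s * c t ≤ c (s ∩ t) * c (s ∪ t))
    (hdd : ∀ s t, d s * d t ≤ d (s ∩ t) * d (s ∪ t))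
    (hd'd' : ∀ s t, d' s * d' t ≤ d' (s ∩ t) * d' (s ∪ t))
    (hcd : ∀ s t, c s * d t ≤ c (s ∩ t) * d (s ∪ t))
    (hcd' : ∀ s t, c s * d' t ≤ c (s ∩ t) * d' (s ∪ t))
    (hdd' : ∀ s t, d s * d' t ≤ d (s ∩ t) * d' (s ∪ t))
    (hratio : ∀ s t, s ⊆ t → d s * c t ≤ c s * d t)
    (hratio' : ∀ s t, s ⊆ t → d' s * c t ≤ c s * d' t)
    (x y : Finset V → R) (hx0 : ∀ W, 0 ≤ x W) (hy0 : ∀ W, 0 ≤ y W)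
    (hxm : ∀ s t, x s ≤ x (s ∪ t)) (hym : ∀ s t, y s ≤ y (s ∪ t))
    (hpos0 : 0 < ∑ W ∈ U.powerset, ν W * c W)
    (hpos1 : 0 < ∑ W ∈ U.powerset, ν W * chainMix ∅ ent' 1 c d W)
    (hmI : 0 < ∑ W ∈ U.powerset.filter (fun W => ¬ ∃ r ∈ ent', r ∈ W), ν W * c W) :
    0 ≤ (∑ W ∈ U.powerset, ν W * c W) ^ 2 *
          ((∑ W ∈ U.powerset, ν W * chainMix ∅ ent' 1 c d W) *
            (∑ W ∈ U.powerset, ν W * chainMix ∅ ent' 1 c d W) *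
            (∑ W ∈ U.powerset, ν W * chainMix ∅ ent' 1 c d' W * (x W * y W))
          - (∑ W ∈ U.powerset, ν W * chainMix ∅ ent' 1 c d W) *
            (∑ W ∈ U.powerset, ν W * chainMix ∅ ent' 1 c d W * y W) *
            (∑ W ∈ U.powerset, ν W * chainMix ∅ ent' 1 c d' W * x W)
          - (∑ W ∈ U.powerset, ν W * chainMix ∅ ent' 1 c d W) *
            (∑ W ∈ U.powerset, ν W * chainMix ∅ ent' 1 c d W * x W) *
            (∑ W ∈ U.powerset, ν W * chainMix ∅ ent' 1 c d' W * y W)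
          + (∑ W ∈ U.powerset, ν W * chainMix ∅ ent' 1 c d W * x W) *
            (∑ W ∈ U.powerset, ν W * chainMix ∅ ent' 1 c d W * y W) *
            (∑ W ∈ U.powerset, ν W * chainMix ∅ ent' 1 c d' W))
        + ((∑ W ∈ U.powerset, ν W * chainMix ∅ ent' 1 c d W) -
            (∑ W ∈ U.powerset, ν W * chainMix ∅ ent' 1 c d' W)) *
          (((∑ W ∈ U.powerset, ν W * chainMix ∅ ent' 1 c d W) * (∑ W ∈ U.powerset, ν W * c W * x W)
              - (∑ W ∈ U.powerset, ν W * c W) * (∑ W ∈ U.powerset, ν W * chainMix ∅ ent' 1 c d W * x W)) *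
            ((∑ W ∈ U.powerset, ν W * chainMix ∅ ent' 1 c d W) * (∑ W ∈ U.powerset, ν W * c W * y W)
              - (∑ W ∈ U.powerset, ν W * c W) * (∑ W ∈ U.powerset, ν W * chainMix ∅ ent' 1 c d W * y W))) := by
  -- names for the moments
  set a0 := ∑ W ∈ U.powerset, ν W * c W with ha0
  set a1 := ∑ W ∈ U.powerset, ν W * c W * x W with ha1
  set a2 := ∑ W ∈ U.powerset, ν W * c W * y W with ha2
  set b0 := ∑ W ∈ U.powerset, ν W * chainMix ∅ ent' 1 c d W with hb0
  set b1 := ∑ W ∈ U.powerset, ν W * chainMix ∅ ent' 1 c d W * x W with hb1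
  set b2 := ∑ W ∈ U.powerset, ν W * chainMix ∅ ent' 1 c d W * y W with hb2'
  set g0 := ∑ W ∈ U.powerset, ν W * chainMix ∅ ent' 1 c d' W with hg0
  set g1 := ∑ W ∈ U.powerset, ν W * chainMix ∅ ent' 1 c d' W * x W with hg1
  set g2 := ∑ W ∈ U.powerset, ν W * chainMix ∅ ent' 1 c d' W * y W with hg2
  set g12 := ∑ W ∈ U.powerset, ν W * chainMix ∅ ent' 1 c d' W * (x W * y W) with hg12
  set m := ∑ W ∈ U.powerset.filter (fun W => ¬ ∃ r ∈ ent', r ∈ W), ν W * c W with hm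
  set xI := ∑ W ∈ U.powerset.filter (fun W => ¬ ∃ r ∈ ent', r ∈ W), ν W * c W * x W with hxI
  set yI := ∑ W ∈ U.powerset.filter (fun W => ¬ ∃ r ∈ ent', r ∈ W), ν W * c W * y W with hyI
  set xyI := ∑ W ∈ U.powerset.filter (fun W => ¬ ∃ r ∈ ent', r ∈ W), ν W * c W * (x W * y W) with hxyI
  set M := ∑ W ∈ U.powerset.filter (fun W => ∃ r ∈ ent', r ∈ W), ν W * c W with hM
  set xM := ∑ W ∈ U.powerset.filter (fun W => ∃ r ∈ ent', r ∈ W), ν W * c W * x W with hxM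
  set yM := ∑ W ∈ U.powerset.filter (fun W => ∃ r ∈ ent', r ∈ W), ν W * c W * y W with hyM
  set r := ∑ W ∈ U.powerset.filter (fun W => ∃ r ∈ ent', r ∈ W), ν W * d W with hr
  set xr := ∑ W ∈ U.powerset.filter (fun W => ∃ r ∈ ent', r ∈ W), ν W * d W * x W with hxr
  set yr := ∑ W ∈ U.powerset.filter (fun W => ∃ r ∈ ent', r ∈ W), ν W * d W * y W with hyr
  set g := ∑ W ∈ U.powerset.filter (fun W => ∃ r ∈ ent', r ∈ W), ν W * d' W with hg
  set Ip := ∑ W ∈ U.powerset.filter (fun W => ¬ ∃ r ∈ ent', r ∈ W), ν W * c W *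
    ((b0 * x W - b1) * (b0 * y W - b2)) with hIpdef
  set Dp := ∑ W ∈ U.powerset.filter (fun W => ∃ r ∈ ent', r ∈ W), ν W * d' W *
    ((b0 * x W - b1) * (b0 * y W - b2)) with hDpdef
  have hsplit : ∀ f : Finset V → R, (∑ W ∈ U.powerset, f W) =
      (∑ W ∈ U.powerset.filter (fun W => ¬ ∃ r ∈ ent', r ∈ W), f W) +
        (∑ W ∈ U.powerset.filter (fun W => ∃ r ∈ ent', r ∈ W), f W) := by
    intro f; rw [add_comm, Finset.sum_filter_add_sum_filter_not]
  have hmeet : ∀ W : Finset V, (∃ r ∈ ent', r ∈ W) → chainMix ∅ ent' 1 c d W = d W := by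
    intro W hW
    apply chainMix_one_of_meet
    obtain ⟨r', hr', hrW⟩ := hW; exact ⟨r', by simpa using hr', hrW⟩
  have hmeet' : ∀ W : Finset V, (∃ r ∈ ent', r ∈ W) → chainMix ∅ ent' 1 c d' W = d' W := by
    intro W hW
    apply chainMix_one_of_meet
    obtain ⟨r', hr', hrW⟩ := hW; exact ⟨r', by simpa using hr', hrW⟩
  have hnomeet : ∀ W : Finset V, (¬ ∃ r ∈ ent', r ∈ W) → chainMix ∅ ent' 1 c d W = c W := by
    intro W hW
    apply chainMix_of_not_meet
    rintro ⟨r', hr', hrW⟩; exact hW ⟨r', by simpa using hr', hrW⟩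
  have hnomeet' : ∀ W : Finset V, (¬ ∃ r ∈ ent', r ∈ W) → chainMix ∅ ent' 1 c d' W = c W := by
    intro W hW
    apply chainMix_of_not_meet
    rintro ⟨r', hr', hrW⟩; exact hW ⟨r', by simpa using hr', hrW⟩
  have ea0 : a0 = m + M := hsplit _
  have ea1 : a1 = xI + xM := hsplit _
  have ea2 : a2 = yI + yM := hsplit _
  have eb0 : b0 = m + r := by
    rw [hb0, hsplit]
    congr 1
    · exact Finset.sum_congr rfl fun W hW => by rw [hnomeet W (Finset.mem_filter.1 hW).2]
    · exact Finset.sum_congr rfl fun W hW => by rw [hmeet W (Finset.mem_filter.1 hW).2]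
  have eb1 : b1 = xI + xr := by
    rw [hb1, hsplit]
    congr 1
    · exact Finset.sum_congr rfl fun W hW => by rw [hnomeet W (Finset.mem_filter.1 hW).2]
    · exact Finset.sum_congr rfl fun W hW => by rw [hmeet W (Finset.mem_filter.1 hW).2]
  have eb2 : b2 = yI + yr := by
    rw [hb2', hsplit]
    congr 1
    · exact Finset.sum_congr rfl fun W hW => by rw [hnomeet W (Finset.mem_filter.1 hW).2]
    · exact Finset.sum_congr rfl fun W hW => by rw [hmeet W (Finset.mem_filter.1 hW).2]
  have eg0 : g0 = m + g := by
    rw [hg0, hsplit]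
    congr 1
    · exact Finset.sum_congr rfl fun W hW => by rw [hnomeet' W (Finset.mem_filter.1 hW).2]
    · exact Finset.sum_congr rfl fun W hW => by rw [hmeet' W (Finset.mem_filter.1 hW).2]
  -- the world-1 functional is the ideal part plus the entered part
  have eU : b0 * b0 * g12 - b0 * b2 * g1 - b0 * b1 * g2 + b1 * b2 * g0 = Ip + Dp := by
    have e1 : ∑ W ∈ U.powerset, ν W * chainMix ∅ ent' 1 c d' W * ((b0 * x W - b1) * (b0 * y W - b2))
        = Ip + Dp := by
      rw [hsplit]
      congr 1
      · exact Finset.sum_congr rfl fun W hW => by rw [hnomeet' W (Finset.mem_filter.1 hW).2]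
      · exact Finset.sum_congr rfl fun W hW => by rw [hmeet' W (Finset.mem_filter.1 hW).2]
    rw [← e1, centred_expand]
  -- the ideal part expanded, and FKG on the ideal
  have eIp : Ip = b0 * b0 * xyI - b0 * b2 * xI - b0 * b1 * yI + b1 * b2 * m := by
    rw [hIpdef, centred_expand]
  have hFKG_I : xI * yI ≤ m * xyI := chain_ideal_fkg U ent' ν c hν0 hν hc0 hcc x y hx0 hy0 hxm hym
  have hIp : (m * b1 - b0 * xI) * (m * b2 - b0 * yI) ≤ m * Ip := by
    rw [eIp]
    have e : m * (b0 * b0 * xyI - b0 * b2 * xI - b0 * b1 * yI + b1 * b2 * m)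
        - (m * b1 - b0 * xI) * (m * b2 - b0 * yI) = b0 * b0 * (m * xyI - xI * yI) := by ring
    have : 0 ≤ b0 * b0 * (m * xyI - xI * yI) :=
      mul_nonneg (mul_nonneg hpos1.le hpos1.le) (by linarith)
    linarith
  -- the closed-gate one-marker bounds: `r (b0 a − a0 b) ≤ a0 (m b − b0 (·)I)`, from `q₀ ≤ q_{rD}`
  have hclosed : ∀ (z : Finset V → R), (∀ W, 0 ≤ z W) → (∀ s t, z s ≤ z (s ∪ t)) →
      ((∑ W ∈ U.powerset.filter (fun W => ¬ ∃ r ∈ ent', r ∈ W), ν W * c W * z W) +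
        (∑ W ∈ U.powerset.filter (fun W => ∃ r ∈ ent', r ∈ W), ν W * c W * z W)) * r ≤
      (m + M) * (∑ W ∈ U.powerset.filter (fun W => ∃ r ∈ ent', r ∈ W), ν W * d W * z W) :=
    fun z hz0 hzm => chain_closed_om U ent' ν c d hν0 hν hc0 hd0 hdd hcd z hz0 hzm
  have hmr : 0 ≤ m + r := by rw [← eb0]; exact hpos1.le
  have hOMx : r * (b0 * a1 - a0 * b1) ≤ a0 * (m * b1 - b0 * xI) := by
    have h : (xI + xM) * r ≤ (m + M) * xr := hclosed x hx0 hxm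
    rw [ea0, ea1, eb0, eb1]
    have e : (m + M) * (m * (xI + xr) - (m + r) * xI) - r * ((m + r) * (xI + xM) - (m + M) * (xI + xr))
        = (m + r) * ((m + M) * xr - (xI + xM) * r) := by ring
    have : 0 ≤ (m + r) * ((m + M) * xr - (xI + xM) * r) := mul_nonneg hmr (by linarith [h])
    linarith [e, this]
  have hOMy : r * (b0 * a2 - a0 * b2) ≤ a0 * (m * b2 - b0 * yI) := by
    have h : (yI + yM) * r ≤ (m + M) * yr := hclosed y hy0 hym
    rw [ea0, ea2, eb0, eb2]
    have e : (m + M) * (m * (yI + yr) - (m + r) * yI) - r * ((m + r) * (yI + yM) - (m + M) * (yI + yr))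
        = (m + r) * ((m + M) * yr - (yI + yM) * r) := by ring
    have : 0 ≤ (m + r) * ((m + M) * yr - (yI + yM) * r) := mul_nonneg hmr (by linarith [h])
    linarith [e, this]
  -- the ideal means below the world-0 and the world-1 means
  have hidx : a0 * xI ≤ m * a1 := by
    have h : xI * a0 ≤ m * a1 := ideal_le_global U ent' ν c x hν0 hν hc0 hcc hx0 hxm
    rw [mul_comm]; exact h
  have hidy : a0 * yI ≤ m * a2 := by
    have h : yI * a0 ≤ m * a2 := ideal_le_global U ent' ν c y hν0 hν hc0 hcc hy0 hym
    rw [mul_comm]; exact h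
  have hqx : b0 * xI ≤ m * b1 := by
    have h : xI * r ≤ m * xr := ideal_le_entered_R U ent' ν c d x hν0 hν hc0 hd0 hcd hx0 hxm
    rw [eb0, eb1]
    calc (m + r) * xI = m * xI + xI * r := by ring
      _ ≤ m * xI + m * xr := by linarith [h]
      _ = m * (xI + xr) := by ring
  have hqy : b0 * yI ≤ m * b2 := by
    have h : yI * r ≤ m * yr := ideal_le_entered_R U ent' ν c d y hν0 hν hc0 hd0 hcd hy0 hym
    rw [eb0, eb2]
    calc (m + r) * yI = m * yI + yI * r := by ring
      _ ≤ m * yI + m * yr := by linarith [h]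
      _ = m * (yI + yr) := by ring
  -- the entered masses
  have hr0 : 0 ≤ r := Finset.sum_nonneg fun W _ => mul_nonneg (hν0 W) (hd0 W)
  have hg0' : 0 ≤ g := Finset.sum_nonneg fun W _ => mul_nonneg (hν0 W) (hd'0 W)
  have hgr : g ≤ r := Finset.sum_le_sum fun W _ => mul_le_mul_of_nonneg_left (hd'd W) (hν0 W)
  have hDp0 : r = 0 → Dp = 0 := fun hrz =>
    chain_entered_gate_zero U ent' ν d d' hν0 hd0 hd'0 hd'd
      (fun W => (b0 * x W - b1) * (b0 * y W - b2)) hrz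
  -- (SC) for the chain
  have hSC : 0 ≤ r * Dp + g * Ip :=
    pureChain_SC U ent' ν c d d' hν0 hν hc0 hd0 hd'0 hdc hd'c hd'd hcc hdd hd'd' hcd hcd' hdd'
      hratio hratio' x y hx0 hy0 hxm hym
  -- (Q′)
  have hQ0 := qprime_of_sc_alg a0 a1 a2 b0 b1 b2 m xI yI Ip Dp r g hmI hpos0.le hpos1.le hr0 hgr hg0'
    hSC hDp0 hIp hOMx hOMy hidx hidy hqx hqy
  rw [← eU] at hQ0
  have e : b0 - g0 = r - g := by rw [eb0, eg0]; ring
  rw [e]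
  exact hQ0

/-- **THE UNIVERSAL PURE AND-SWITCH CHAIN.** Under the head hypotheses, `d' ≤ d`, positive world
masses and a positive ideal mass, the pure chain functional is nonnegative at EVERY `ρ ∈ [0, 1]`
for every pair of nonnegative increasing markers — no further hypothesis. -/
theorem pureChain_functional_nonneg_universal (U ent' : Finset V) (ν c d d' : Finset V → R)
    (ρ : R) (hρ0 : 0 ≤ ρ) (hρ1 : ρ ≤ 1) (hν0 : ∀ W, 0 ≤ ν W)
    (hν : ∀ s ⊆ U, ∀ t ⊆ U, ν s * ν t ≤ ν (s ∩ t) * ν (s ∪ t))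
    (hc0 : ∀ W, 0 ≤ c W) (hd0 : ∀ W, 0 ≤ d W) (hd'0 : ∀ W, 0 ≤ d' W)
    (hdc : ∀ W, d W ≤ c W) (hd'c : ∀ W, d' W ≤ c W) (hd'd : ∀ W, d' W ≤ d W)
    (hcc : ∀ s t, c s * c t ≤ c (s ∩ t) * c (s ∪ t))
    (hdd : ∀ s t, d s * d t ≤ d (s ∩ t) * d (s ∪ t))
    (hd'd' : ∀ s t, d' s * d' t ≤ d' (s ∩ t) * d' (s ∪ t))
    (hcd : ∀ s t, c s * d t ≤ c (s ∩ t) * d (s ∪ t))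
    (hcd' : ∀ s t, c s * d' t ≤ c (s ∩ t) * d' (s ∪ t))
    (hdd' : ∀ s t, d s * d' t ≤ d (s ∩ t) * d' (s ∪ t))
    (hratio : ∀ s t, s ⊆ t → d s * c t ≤ c s * d t)
    (hratio' : ∀ s t, s ⊆ t → d' s * c t ≤ c s * d' t)
    (x y : Finset V → R) (hx0 : ∀ W, 0 ≤ x W) (hy0 : ∀ W, 0 ≤ y W)
    (hxm : ∀ s t, x s ≤ x (s ∪ t)) (hym : ∀ s t, y s ≤ y (s ∪ t))
    (hpos0 : 0 < ∑ W ∈ U.powerset, ν W * c W)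
    (hpos1 : 0 < ∑ W ∈ U.powerset, ν W * chainMix ∅ ent' 1 c d W)
    (hmI : 0 < ∑ W ∈ U.powerset.filter (fun W => ¬ ∃ r ∈ ent', r ∈ W), ν W * c W) :
    0 ≤ (∑ W ∈ U.powerset, ν W * chainMix ∅ ent' ρ c d W) ^ 2 *
          (∑ W ∈ U.powerset, ν W * chainMix ∅ ent' ρ c d' W * (x W * y W))
        - (∑ W ∈ U.powerset, ν W * chainMix ∅ ent' ρ c d W) *
          (∑ W ∈ U.powerset, ν W * chainMix ∅ ent' ρ c d W * x W) *
          (∑ W ∈ U.powerset, ν W * chainMix ∅ ent' ρ c d' W * y W)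
        - (∑ W ∈ U.powerset, ν W * chainMix ∅ ent' ρ c d W) *
          (∑ W ∈ U.powerset, ν W * chainMix ∅ ent' ρ c d W * y W) *
          (∑ W ∈ U.powerset, ν W * chainMix ∅ ent' ρ c d' W * x W)
        + (∑ W ∈ U.powerset, ν W * chainMix ∅ ent' ρ c d W * x W) *
          (∑ W ∈ U.powerset, ν W * chainMix ∅ ent' ρ c d W * y W) *
          (∑ W ∈ U.powerset, ν W * chainMix ∅ ent' ρ c d' W) :=
  pureChain_functional_nonneg_of_Qprime U ent' ν c d d' ρ hρ0 hρ1 hν0 hν hc0 hd0 hd'0 hdc hd'c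
    hcc hdd hd'd' hcd hcd' hdd' hratio hratio' x y hx0 hy0 hxm hym hpos0 hpos1
    (pureChain_Qprime U ent' ν c d d' hν0 hν hc0 hd0 hd'0 hdc hd'c hd'd hcc hdd hd'd' hcd hcd' hdd'
      hratio hratio' x y hx0 hy0 hxm hym hpos0 hpos1 hmI)

end QprimeMain

end Summit.Ventures.PercRepro2.Coin
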